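import Literature.NumberTheory.Sieve.SmoothProfileSumsTransfer
import HarnessLib

/-!
# Minor arcs for sharp box-masked friable exponential sums with a dilation — lemmas

Topic `Literature/NumberTheory/Sieve`; a PROVED tool file ([Harper2016, §5, Proposition 5], our packaged
forms).  The tree's pointwise minor-arc bound `norm_smoothExpSum_le_of_minor` (SmoothMinorArcsSup) controls the
SHARP sum `∑_{n ∈ S(x,y)} e(nθ)` for `θ` off the major arcs `𝔐(R) = ⋃_{q ≤ R} ⋃_a {|θ − a/q| ≤ R/x}`.  In the
circle method for friable solutions of `d₁n₁ ± d₂n₂ = d₃n₃` with the variables in BOXES `S(X,y) ∖ S(X',y)`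
(possibly restricted to a parity class) the third generating function is `∑_{n ∈ box} e(n·d·θ)`, a dilate by
`d ≥ 1` of a difference of two sharp sums at the scales `X' ≤ X ≤ x`, while the arcs are those of the MASTER
scale `x` (`q ≤ R`, radius `R/x`).  This file transports the minor-arc property through the dilation and the
change of scale, with the dependence on the saddle point made uniform (`α(Z,y) ≥ 1 − 10⁻⁴`):

* `SharpMinor.minor_mul_nat` — if `|θ − a/q| > ρ` for all `q ≤ R`, then `|dθ − a/q| > dρ` for all `q ≤ R/d`;
* `SharpMinor.norm_smoothExpSum_dilate_le_of_minor` — the tree's bound at a scale `Z ≤ x` for the frequency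
  `dθ`, `θ ∉ 𝔐(R)` (master arcs), with the effective denominator bound `R_Z = RZ/(dx) ≥ 1`;
* `SharpMinor.norm_smoothExpSum_dilate_le_uniform` — the same with `y^{5/2(1−α)} ≤ y^{1/4000}` and
  `R_Z^{−1/2+3/2(1−α)} ≤ s^{49/100}` whenever `R_Z ≥ 1/s ≥ 1`;
* `SharpMinor.norm_boxExpSum_le_explicit` — the box `S(X) ∖ S(X')`: the two scale terms added;
* `SharpMinor.sum_sdiff_filter_even_eq` — the even members of a box are `2·(S(X/2) ∖ S(X'/2))`.

The eventual packaging (tied `y = ⌊(log x)^{100000}⌋`, all boxes above `x/(log x)^B`) is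
`SmoothSharpMinorArcs.lean`.

## References

* A. J. Harper, *Minor arcs, mean values, and restriction theory for exponential sums over smooth numbers*,
  Compositio Math. 152 (2016) 1121–1158, §5, Proposition 5 [Harper2016].
* A. Hildebrand, G. Tenenbaum, Trans. AMS 296 (1986), Thm 1–2 [HildebrandTenenbaum1986].
-/

noncomputable section

open Finset Filter Real
open scoped FourierTransform

namespace Literature.NumberTheory.Sieve

namespace SharpMinor

/-! ### Transport of the minor-arc property through a dilation -/

/-- **Dilating a minor point.**  If `|θ − a/q| > ρ` for all `1 ≤ q ≤ R` and all `a ∈ ℤ`, then for `d ≥ 1`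
the point `dθ` satisfies `|dθ − a/q| > dρ` for all `1 ≤ q ≤ R/d`, `a ∈ ℤ` (`dθ − a/q = d(θ − a/(dq))` and
`dq ≤ R`). [folklore] -/
theorem minor_mul_nat {R ρ θ : ℝ} {d : ℕ} (hd : 1 ≤ d)
    (h : ∀ q : ℕ, 1 ≤ q → (q : ℝ) ≤ R → ∀ a : ℤ, ρ < |θ - a / q|) :
    ∀ q : ℕ, 1 ≤ q → (q : ℝ) ≤ R / d → ∀ a : ℤ, d * ρ < |(d : ℝ) * θ - a / q| := by
  intro q hq hqR a
  have hd0 : (0 : ℝ) < d := by exact_mod_cast hd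
  have hq0 : (0 : ℝ) < q := by exact_mod_cast hq
  have hdq : ((d * q : ℕ) : ℝ) ≤ R := by
    rw [le_div_iff₀' hd0] at hqR
    exact_mod_cast hqR
  have key := h (d * q) (Nat.one_le_iff_ne_zero.2 (Nat.mul_ne_zero (by omega) (by omega))) hdq a
  have hrw : (d : ℝ) * θ - a / q = d * (θ - a / ((d * q : ℕ) : ℝ)) := by
    push_cast
    field_simp
  rw [hrw, abs_mul, abs_of_pos hd0]
  exact mul_lt_mul_of_pos_left key hd0

/-! ### The pointwise bound at a scale `Z ≤ x` for the frequency `dθ` -/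

/-- **The tree's minor-arc bound, dilated and at a smaller scale.**  Let `C, x₀` be as in
`norm_smoothExpSum_le_of_minor`.  For `x₀ ≤ Z ≤ x` in Harper's range at the scale `Z` (`(log Z)⁸ ≤ y`,
`log y ≤ (log Z)^{1/6}`, `y^{40} ≤ Z`), `d ≥ 1`, `R ≤ x^{1/5}` with `dx ≤ RZ`, and `θ` off the master major arcs
(`|θ − a/q| > R/x` for all `q ≤ R`), the frequency `dθ` is off the arcs of the scale `Z` with denominator bound
`R_Z = RZ/(dx) ∈ [1, Z^{1/5}]` (`q ≤ R_Z ⇒ dq ≤ R`, and `|dθ − a/q| > dR/x ≥ R_Z/Z`), so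
`|∑_{n ∈ S(Z,y)} e(n dθ)| ≤ C (log Z)³ y^{5/2(1−α)} R_Z^{−1/2+3/2(1−α)} 𝓟(Z) + 41 (1 + log Z)² y² Z^{9/10}`,
`α = α(Z, y)`, `𝓟(Z) = Z^α ζ(α,y)/√φ₂(α,y)`. [cite: Harper2016, §5, Proposition 5] -/
theorem norm_smoothExpSum_dilate_le_of_minor :
    ∃ C x₀ : ℝ, 0 < C ∧ ∀ (x Z : ℝ) (y : ℕ), x₀ ≤ Z → Real.log Z ^ 8 ≤ y →
      Real.log y ≤ Real.log Z ^ (1 / 6 : ℝ) → (y : ℝ) ^ 40 ≤ Z → Z ≤ x →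
      ∀ d : ℕ, 1 ≤ d → ∀ R : ℝ, (d : ℝ) * x ≤ R * Z → R ≤ x ^ (1 / 5 : ℝ) →
      ∀ θ : ℝ, (∀ q : ℕ, 1 ≤ q → (q : ℝ) ≤ R → ∀ a : ℤ, R / x < |θ - a / q|) →
        ‖∑ n ∈ Nat.smoothNumbersUpTo ⌊Z⌋₊ (y + 1), (𝐞 ((n : ℝ) * ((d : ℝ) * θ)) : ℂ)‖ ≤
          C * Real.log Z ^ 3 * (y : ℝ) ^ (5 / 2 * (1 - saddlePoint Z y)) *
            (R * Z / ((d : ℝ) * x)) ^ (-(1 / 2 : ℝ) + 3 / 2 * (1 - saddlePoint Z y)) *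
            (Z ^ saddlePoint Z y *
              (smoothZeta (saddlePoint Z y) y / Real.sqrt (saddlePhi₂ (saddlePoint Z y) y))) +
          41 * (1 + Real.log Z) ^ 2 * (y : ℝ) ^ 2 * Z ^ (9 / 10 : ℝ) := by
  obtain ⟨C, x₀, hC, h⟩ := norm_smoothExpSum_le_of_minor
  refine ⟨C, max x₀ 1, hC, fun x Z y hZ hy8 hy6 hy40 hZx d hd R hR hRx θ hminor => ?_⟩
  have hx₀ : x₀ ≤ Z := (le_max_left _ _).trans hZ
  have hZ1 : 1 ≤ Z := (le_max_right _ _).trans hZ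
  have hZ0 : 0 < Z := by linarith
  have hx0 : 0 < x := by linarith
  have hd1 : (1 : ℝ) ≤ d := by exact_mod_cast hd
  have hd0 : (0 : ℝ) < d := by linarith
  have hdx : 0 < (d : ℝ) * x := mul_pos hd0 hx0
  have hR0 : 0 < R := by
    by_contra hle
    push Not at hle
    have : R * Z ≤ 0 := mul_nonpos_of_nonpos_of_nonneg hle hZ0.le
    linarith
  set RZ : ℝ := R * Z / ((d : ℝ) * x) with hRZ
  have hRZ1 : 1 ≤ RZ := by rw [hRZ, le_div_iff₀ hdx, one_mul]; exact hR
  have hRZle : RZ ≤ Z ^ (1 / 5 : ℝ) := by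
    rw [hRZ, div_le_iff₀ hdx]
    have h2 : Z ^ (4 / 5 : ℝ) ≤ x ^ (4 / 5 : ℝ) := Real.rpow_le_rpow hZ0.le hZx (by norm_num)
    have h3 : x ^ (1 / 5 : ℝ) * x ^ (4 / 5 : ℝ) = x := by
      rw [← Real.rpow_add hx0]; norm_num
    calc R * Z = R * (Z ^ (4 / 5 : ℝ) * Z ^ (1 / 5 : ℝ)) := by
          rw [← Real.rpow_add hZ0]; norm_num
      _ ≤ x ^ (1 / 5 : ℝ) * (x ^ (4 / 5 : ℝ) * Z ^ (1 / 5 : ℝ)) := by gcongr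
      _ = 1 * x * Z ^ (1 / 5 : ℝ) := by rw [← mul_assoc, h3, one_mul]
      _ ≤ (d : ℝ) * x * Z ^ (1 / 5 : ℝ) := by gcongr
      _ = Z ^ (1 / 5 : ℝ) * ((d : ℝ) * x) := by ring
  -- the dilated frequency is off the arcs of the scale `Z`
  have hminor' : ∀ q : ℕ, 1 ≤ q → (q : ℝ) ≤ RZ → ∀ a : ℤ, RZ / Z < |(d : ℝ) * θ - a / q| := by
    have hm := minor_mul_nat (ρ := R / x) hd hminor
    intro q hq hqR a
    have hRZd : RZ ≤ R / d := by
      rw [hRZ, div_le_div_iff₀ hdx hd0]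
      calc R * Z * d = R * d * Z := by ring
        _ ≤ R * d * x := by gcongr
        _ = R * ((d : ℝ) * x) := by ring
    have h1 := hm q hq (hqR.trans hRZd) a
    have h2 : RZ / Z ≤ d * (R / x) := by
      rw [hRZ, div_le_iff₀ hZ0]
      rw [div_le_iff₀ hdx]
      have : R * Z ≤ R * Z * ((d : ℝ) * d) := by
        have hdd : (1 : ℝ) ≤ (d : ℝ) * d := one_le_mul_of_one_le_of_one_le hd1 hd1
        exact le_mul_of_one_le_right (by positivity) hdd
      calc R * Z ≤ R * Z * ((d : ℝ) * d) := this
        _ = (d : ℝ) * (R / x) * Z * ((d : ℝ) * x) := by field_simp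
    exact lt_of_le_of_lt h2 h1
  exact h Z y hx₀ hy8 hy6 hy40 RZ hRZ1 hRZle ((d : ℝ) * θ) hminor'

/-- **Uniform form of the dilated bound.**  In the polylog-type regime at the scale `Z` (`(log Z)⁸ ≤ y`,
`log y ≤ ½ (log Z)^{1/6}`, `y^{200} ≤ Z`, `α(Z,y) ≥ 1 − 10⁻⁴`), for `Z ≤ x`, `d ≥ 1`, `0 < s ≤ 1` with
`dx ≤ sRZ` (i.e. `R_Z = RZ/(dx) ≥ 1/s`), `R ≤ x^{1/5}` and `θ ∉ 𝔐(R)`: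
`|∑_{n ∈ S(Z,y)} e(n dθ)| ≤ C (log Z)³ y^{1/4000} s^{49/100} 𝓟(Z) + 41 (1 + log Z)² y² Z^{9/10}`
(`y^{5/2(1−α)} ≤ y^{1/4000}` and `R_Z^{−1/2+3/2(1−α)} ≤ (1/s)^{−1/2+3/2(1−α)} ≤ s^{49/100}`).
[cite: Harper2016, §5, Proposition 5] -/
theorem norm_smoothExpSum_dilate_le_uniform :
    ∃ C x₀ : ℝ, 0 < C ∧ ∀ (x Z s R θ : ℝ) (y d : ℕ), x₀ ≤ Z → Real.log Z ^ 8 ≤ y →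
      Real.log y ≤ 1 / 2 * Real.log Z ^ (1 / 6 : ℝ) → (y : ℝ) ^ 200 ≤ Z →
      1 - 1 / 10000 ≤ saddlePoint Z y → Z ≤ x → 1 ≤ d → 0 < s → s ≤ 1 →
      (d : ℝ) * x ≤ s * R * Z → R ≤ x ^ (1 / 5 : ℝ) →
      (∀ q : ℕ, 1 ≤ q → (q : ℝ) ≤ R → ∀ a : ℤ, R / x < |θ - a / q|) →
        ‖∑ n ∈ Nat.smoothNumbersUpTo ⌊Z⌋₊ (y + 1), (𝐞 ((n : ℝ) * ((d : ℝ) * θ)) : ℂ)‖ ≤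
          C * Real.log Z ^ 3 * (y : ℝ) ^ (1 / 4000 : ℝ) * s ^ (49 / 100 : ℝ) *
            (Z ^ saddlePoint Z y *
              (smoothZeta (saddlePoint Z y) y / Real.sqrt (saddlePhi₂ (saddlePoint Z y) y))) +
          41 * (1 + Real.log Z) ^ 2 * (y : ℝ) ^ 2 * Z ^ (9 / 10 : ℝ) := by
  obtain ⟨C, x₀, hC, h⟩ := norm_smoothExpSum_dilate_le_of_minor
  refine ⟨C, max x₀ (Real.exp 1), hC,
    fun x Z s R θ y d hZ hy8 hy6 hy200 hα hZx hd hs0 hs1 hR hRx hminor => ?_⟩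
  have hx₀ : x₀ ≤ Z := (le_max_left _ _).trans hZ
  have hZe : Real.exp 1 ≤ Z := (le_max_right _ _).trans hZ
  have hZ0 : 0 < Z := lt_of_lt_of_le (Real.exp_pos 1) hZe
  have hLZ1 : 1 ≤ Real.log Z := by rw [Real.le_log_iff_exp_le hZ0]; exact hZe
  have hLZ0 : 0 ≤ Real.log Z := by linarith
  have hy1 : (1 : ℝ) ≤ y := le_trans (one_le_pow₀ hLZ1) hy8
  have hy6' : Real.log y ≤ Real.log Z ^ (1 / 6 : ℝ) := by
    have h0 : 0 ≤ Real.log Z ^ (1 / 6 : ℝ) := Real.rpow_nonneg hLZ0 _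
    linarith
  have hy40 : (y : ℝ) ^ 40 ≤ Z := le_trans (pow_le_pow_right₀ hy1 (by norm_num)) hy200
  have hx0 : 0 < x := lt_of_lt_of_le hZ0 hZx
  have hd1 : (1 : ℝ) ≤ d := by exact_mod_cast hd
  have hdx : 0 < (d : ℝ) * x := by positivity
  have hRZ0 : 0 < R * Z := by
    have h1 : 0 < s * R * Z := lt_of_lt_of_le hdx hR
    have h2 : s * R * Z = s * (R * Z) := by ring
    rw [h2] at h1
    exact pos_of_mul_pos_right h1 hs0.le
  have hRZ : (d : ℝ) * x ≤ R * Z := by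
    refine hR.trans ?_
    calc s * R * Z = s * (R * Z) := by ring
      _ ≤ 1 * (R * Z) := by gcongr
      _ = R * Z := one_mul _
  have key := h x Z y hx₀ hy8 hy6' hy40 hZx d hd R hRZ hRx θ hminor
  refine key.trans (add_le_add_left ?_ _)
  -- uniformise the main term
  have hP0 : 0 ≤ Z ^ saddlePoint Z y *
      (smoothZeta (saddlePoint Z y) y / Real.sqrt (saddlePhi₂ (saddlePoint Z y) y)) := by
    have : 0 < smoothZeta (saddlePoint Z y) y := smoothZeta_pos (by linarith)
    positivity
  have h1 : (y : ℝ) ^ (5 / 2 * (1 - saddlePoint Z y)) ≤ (y : ℝ) ^ (1 / 4000 : ℝ) :=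
    Real.rpow_le_rpow_of_exponent_le hy1 (by linarith)
  set RZ : ℝ := R * Z / ((d : ℝ) * x) with hRZdef
  have hRZge : 1 / s ≤ RZ := by
    rw [hRZdef, le_div_iff₀ hdx, div_mul_eq_mul_div, div_le_iff₀ hs0, one_mul]
    linarith
  set e : ℝ := -(1 / 2 : ℝ) + 3 / 2 * (1 - saddlePoint Z y) with he
  have he0 : e ≤ 0 := by rw [he]; linarith
  have he49 : 49 / 100 ≤ -e := by rw [he]; linarith
  have h2 : RZ ^ e ≤ (1 / s) ^ e := Real.rpow_le_rpow_of_nonpos (by positivity) hRZge he0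
  have h3 : (1 / s) ^ e = s ^ (-e) := by
    rw [one_div, Real.inv_rpow hs0.le, ← Real.rpow_neg hs0.le]
  have h4 : s ^ (-e) ≤ s ^ (49 / 100 : ℝ) := Real.rpow_le_rpow_of_exponent_ge hs0 hs1 he49
  have h5 : RZ ^ e ≤ s ^ (49 / 100 : ℝ) := h2.trans (h3 ▸ h4)
  have h6 : 0 ≤ C * Real.log Z ^ 3 := by positivity
  refine mul_le_mul_of_nonneg_right ?_ hP0
  exact mul_le_mul (mul_le_mul_of_nonneg_left h1 h6) h5 (Real.rpow_nonneg (by positivity) _)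
    (by positivity)

/-! ### Boxes -/

/-- **Minor-arc bound for a sharp friable BOX, explicit form.**  For scales `x₀ ≤ X' ≤ X ≤ x`, both in the
polylog-type regime (`(log Z)⁸ ≤ y`, `log y ≤ ½ (log Z)^{1/6}`, `y^{200} ≤ Z`, `α(Z,y) ≥ 1 − 10⁻⁴` for
`Z ∈ {X, X'}`), a dilation `d ≥ 1`, `0 < s ≤ 1` with `dx ≤ sRX'`, `R ≤ x^{1/5}` and `θ ∉ 𝔐(R)` (master arcs:
`|θ − a/q| > R/x` for all `q ≤ R`):
`|∑_{n ∈ S(X,y) ∖ S(X',y)} e(n dθ)| ≤ C (log x)³ y^{1/4000} s^{49/100} (𝓟(X) + 𝓟(X')) + 82 (1 + log x)² y² x^{9/10}`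
(`S(X') ⊆ S(X)`, so the box sum is the difference of the two sharp sums, each bounded by
`norm_smoothExpSum_dilate_le_uniform`). [cite: Harper2016, §5, Proposition 5] -/
theorem norm_boxExpSum_le_explicit :
    ∃ C x₀ : ℝ, 0 < C ∧ ∀ (x X X' s R θ : ℝ) (y d : ℕ),
      x₀ ≤ X' → X' ≤ X → X ≤ x →
      Real.log X ^ 8 ≤ y → Real.log y ≤ 1 / 2 * Real.log X ^ (1 / 6 : ℝ) → (y : ℝ) ^ 200 ≤ X →
      1 - 1 / 10000 ≤ saddlePoint X y →
      Real.log X' ^ 8 ≤ y → Real.log y ≤ 1 / 2 * Real.log X' ^ (1 / 6 : ℝ) → (y : ℝ) ^ 200 ≤ X' →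
      1 - 1 / 10000 ≤ saddlePoint X' y →
      1 ≤ d → 0 < s → s ≤ 1 → (d : ℝ) * x ≤ s * R * X' → R ≤ x ^ (1 / 5 : ℝ) →
      (∀ q : ℕ, 1 ≤ q → (q : ℝ) ≤ R → ∀ a : ℤ, R / x < |θ - a / q|) →
        ‖∑ n ∈ Nat.smoothNumbersUpTo ⌊X⌋₊ (y + 1) \ Nat.smoothNumbersUpTo ⌊X'⌋₊ (y + 1),
            (𝐞 ((n : ℝ) * ((d : ℝ) * θ)) : ℂ)‖ ≤
          C * Real.log x ^ 3 * (y : ℝ) ^ (1 / 4000 : ℝ) * s ^ (49 / 100 : ℝ) *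
              (X ^ saddlePoint X y *
                  (smoothZeta (saddlePoint X y) y / Real.sqrt (saddlePhi₂ (saddlePoint X y) y)) +
                X' ^ saddlePoint X' y *
                  (smoothZeta (saddlePoint X' y) y / Real.sqrt (saddlePhi₂ (saddlePoint X' y) y))) +
            82 * (1 + Real.log x) ^ 2 * (y : ℝ) ^ 2 * x ^ (9 / 10 : ℝ) := by
  classical
  obtain ⟨C, x₀, hC, h⟩ := norm_smoothExpSum_dilate_le_uniform
  refine ⟨C, max x₀ 1, hC, fun x X X' s R θ y d hX' hX'X hXx h8 h6 h200 hα h8' h6' h200' hα' hd hs0 hs1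
    hR hRx hminor => ?_⟩
  have hx₀' : x₀ ≤ X' := (le_max_left _ _).trans hX'
  have hx₀ : x₀ ≤ X := hx₀'.trans hX'X
  have hX'1 : 1 ≤ X' := (le_max_right _ _).trans hX'
  have hX1 : 1 ≤ X := hX'1.trans hX'X
  have hx1 : 1 ≤ x := hX1.trans hXx
  have hX'0 : 0 < X' := by linarith
  have hX0 : 0 < X := by linarith
  have hd1 : (1 : ℝ) ≤ d := by exact_mod_cast hd
  have hsR : 0 ≤ s * R := by
    have h1 : 0 < s * R * X' := lt_of_lt_of_le (by positivity) hR
    exact (pos_of_mul_pos_left h1 hX'0.le).le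
  have hRX : (d : ℝ) * x ≤ s * R * X := hR.trans (mul_le_mul_of_nonneg_left hX'X hsR)
  have hbX := h x X s R θ y d hx₀ h8 h6 h200 hα hXx hd hs0 hs1 hRX hRx hminor
  have hbX' := h x X' s R θ y d hx₀' h8' h6' h200' hα' (hX'X.trans hXx) hd hs0 hs1 hR hRx hminor
  have hsub : Nat.smoothNumbersUpTo ⌊X'⌋₊ (y + 1) ⊆ Nat.smoothNumbersUpTo ⌊X⌋₊ (y + 1) := by
    intro a ha
    rw [Nat.mem_smoothNumbersUpTo] at ha ⊢
    exact ⟨ha.1.trans (Nat.floor_le_floor hX'X), ha.2⟩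
  rw [Finset.sum_sdiff_eq_sub hsub]
  refine (norm_sub_le _ _).trans ?_
  -- compare the scale quantities with those of `x`
  have hLX : Real.log X ≤ Real.log x := Real.log_le_log hX0 hXx
  have hLX' : Real.log X' ≤ Real.log x := Real.log_le_log hX'0 (hX'X.trans hXx)
  have hLX0 : 0 ≤ Real.log X := Real.log_nonneg hX1
  have hLX'0 : 0 ≤ Real.log X' := Real.log_nonneg hX'1
  have hP0 : 0 ≤ X ^ saddlePoint X y *
      (smoothZeta (saddlePoint X y) y / Real.sqrt (saddlePhi₂ (saddlePoint X y) y)) := by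
    have : 0 < smoothZeta (saddlePoint X y) y := smoothZeta_pos (by linarith)
    positivity
  have hP0' : 0 ≤ X' ^ saddlePoint X' y *
      (smoothZeta (saddlePoint X' y) y / Real.sqrt (saddlePhi₂ (saddlePoint X' y) y)) := by
    have : 0 < smoothZeta (saddlePoint X' y) y := smoothZeta_pos (by linarith)
    positivity
  have hYS : 0 ≤ C * (y : ℝ) ^ (1 / 4000 : ℝ) * s ^ (49 / 100 : ℝ) := by positivity
  have h1 : C * Real.log X ^ 3 * (y : ℝ) ^ (1 / 4000 : ℝ) * s ^ (49 / 100 : ℝ) *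
      (X ^ saddlePoint X y * (smoothZeta (saddlePoint X y) y / Real.sqrt (saddlePhi₂ (saddlePoint X y) y))) ≤
      C * Real.log x ^ 3 * (y : ℝ) ^ (1 / 4000 : ℝ) * s ^ (49 / 100 : ℝ) *
      (X ^ saddlePoint X y * (smoothZeta (saddlePoint X y) y / Real.sqrt (saddlePhi₂ (saddlePoint X y) y))) := by
    apply mul_le_mul_of_nonneg_right _ hP0
    calc C * Real.log X ^ 3 * (y : ℝ) ^ (1 / 4000 : ℝ) * s ^ (49 / 100 : ℝ)
        = C * (y : ℝ) ^ (1 / 4000 : ℝ) * s ^ (49 / 100 : ℝ) * Real.log X ^ 3 := by ring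
      _ ≤ C * (y : ℝ) ^ (1 / 4000 : ℝ) * s ^ (49 / 100 : ℝ) * Real.log x ^ 3 := by gcongr
      _ = _ := by ring
  have h2 : C * Real.log X' ^ 3 * (y : ℝ) ^ (1 / 4000 : ℝ) * s ^ (49 / 100 : ℝ) *
      (X' ^ saddlePoint X' y * (smoothZeta (saddlePoint X' y) y / Real.sqrt (saddlePhi₂ (saddlePoint X' y) y))) ≤
      C * Real.log x ^ 3 * (y : ℝ) ^ (1 / 4000 : ℝ) * s ^ (49 / 100 : ℝ) *
      (X' ^ saddlePoint X' y * (smoothZeta (saddlePoint X' y) y / Real.sqrt (saddlePhi₂ (saddlePoint X' y) y))) := by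
    apply mul_le_mul_of_nonneg_right _ hP0'
    calc C * Real.log X' ^ 3 * (y : ℝ) ^ (1 / 4000 : ℝ) * s ^ (49 / 100 : ℝ)
        = C * (y : ℝ) ^ (1 / 4000 : ℝ) * s ^ (49 / 100 : ℝ) * Real.log X' ^ 3 := by ring
      _ ≤ C * (y : ℝ) ^ (1 / 4000 : ℝ) * s ^ (49 / 100 : ℝ) * Real.log x ^ 3 := by gcongr
      _ = _ := by ring
  have h3 : 41 * (1 + Real.log X) ^ 2 * (y : ℝ) ^ 2 * X ^ (9 / 10 : ℝ) ≤
      41 * (1 + Real.log x) ^ 2 * (y : ℝ) ^ 2 * x ^ (9 / 10 : ℝ) := by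
    have : X ^ (9 / 10 : ℝ) ≤ x ^ (9 / 10 : ℝ) := Real.rpow_le_rpow hX0.le hXx (by norm_num)
    gcongr
  have h4 : 41 * (1 + Real.log X') ^ 2 * (y : ℝ) ^ 2 * X' ^ (9 / 10 : ℝ) ≤
      41 * (1 + Real.log x) ^ 2 * (y : ℝ) ^ 2 * x ^ (9 / 10 : ℝ) := by
    have : X' ^ (9 / 10 : ℝ) ≤ x ^ (9 / 10 : ℝ) := Real.rpow_le_rpow hX'0.le (hX'X.trans hXx) (by norm_num)
    gcongr
  linarith

/-! ### Parity inside a box -/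

/-- **The even members of a friable box are `2·(S(X/2) ∖ S(X'/2))`** (`y ≥ 2`): for `f : ℕ → ℂ`,
`∑_{n ∈ S(X)∖S(X'), n even} f(n) = ∑_{m ∈ S(X/2)∖S(X'/2)} f(2m)`. [folklore] -/
theorem sum_sdiff_filter_even_eq {X X' : ℝ} {y : ℕ} (hy : 2 ≤ y) (f : ℕ → ℂ) :
    ∑ n ∈ (Nat.smoothNumbersUpTo ⌊X⌋₊ (y + 1) \ Nat.smoothNumbersUpTo ⌊X'⌋₊ (y + 1)).filter
        (fun n => n ≡ 0 [MOD 2]), f n =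
      ∑ m ∈ Nat.smoothNumbersUpTo ⌊X / 2⌋₊ (y + 1) \ Nat.smoothNumbersUpTo ⌊X' / 2⌋₊ (y + 1),
        f (2 * m) := by
  classical
  have hinj : Function.Injective (fun n : ℕ => 2 * n) := fun a b hab =>
    Nat.eq_of_mul_eq_mul_left two_pos hab
  have hfilt : (Nat.smoothNumbersUpTo ⌊X⌋₊ (y + 1) \ Nat.smoothNumbersUpTo ⌊X'⌋₊ (y + 1)).filter
      (fun n => n ≡ 0 [MOD 2]) =
      (Nat.smoothNumbersUpTo ⌊X⌋₊ (y + 1)).filter (fun n => n ≡ 0 [MOD 2]) \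
        (Nat.smoothNumbersUpTo ⌊X'⌋₊ (y + 1)).filter (fun n => n ≡ 0 [MOD 2]) := by
    ext n
    simp only [Finset.mem_filter, Finset.mem_sdiff]
    tauto
  rw [hfilt, SmoothArcs.filter_even_eq_image hy, SmoothArcs.filter_even_eq_image hy,
    ← Finset.image_sdiff _ _ hinj, Finset.sum_image fun a _ b _ hab => hinj hab]

end SharpMinor

end Literature.NumberTheory.Sieve

end
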